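import Summits.CriticalPhenomena.PercolationContinuityZ3.Theorems.PercNearOneGluingNoHeavyLowerTailSahiHittingDepthTwoFive
import HarnessLib

/-!
# `NoHeavyLowerTail` (stmt-CriticalPhenomena-4575) — a REFLECTIVE identity checker for sparse integer polynomials (term lists)

Support file, seat `prim-l12-p5` (gen 9), `--supports stmt-CriticalPhenomena-4575`.  Standard axioms; the definitions are computable list operations on the
term lists `List (ℤ × (Fin k → ℕ))` of `…SahiHittingDepthTwoFive` (`evalLV`); no sorries.
WHY.  The Sahi-functional certificates of this programme are polynomial identities "E_n with the hitting moments substituted = certified term list";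
from order 6 on (and for the coin-step LP certificates at order 5) the direct symbolic expansion has > 10⁴ intermediate monomials and exceeds the farm's
elaboration window.  Here the expansion is moved into compiled code: `pmulL`/`pscaleL`/`++` build the product polynomial as DATA, `collect` merges equal
exponents, `isZeroL` tests that every merged coefficient vanishes, and the soundness theorems (`evalLV_pmulL`, `evalLV_collect`, `evalLV_eq_of_isZeroL`)
turn one `native_decide`/`decide` of `isZeroL (L ++ pnegL M)` into the real identity `evalLV L x = evalLV M x` for all `x`.
* `pscaleL`, `pnegL`, `pmulL`, `poneL`, `prodL` (product of a list of term lists), `addTerm`, `collect`, `isZeroL`;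
* `evalLV_pscaleL`, `evalLV_pnegL`, `evalLV_mulTerm`, `evalLV_pmulL`, `evalLV_poneL`, `evalLV_prodL`, `evalLV_addTerm`, `evalLV_collect`,
  `evalLV_eq_zero_of_isZeroL`, **`evalLV_eq_of_isZeroL`**. [this work; folklore (proof by reflection)]
-/

namespace Summit.CriticalPhenomena.PercolationContinuityZ3.Theorems

namespace SahiHitting

open Finset

variable {k : ℕ}

/-! ## Operations on term lists -/

/-- Scalar multiple of a term list. [folklore] -/
def pscaleL (c : ℤ) (L : List (ℤ × (Fin k → ℕ))) : List (ℤ × (Fin k → ℕ)) := L.map fun t => (c * t.1, t.2)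

/-- Negation of a term list. [folklore] -/
def pnegL (L : List (ℤ × (Fin k → ℕ))) : List (ℤ × (Fin k → ℕ)) := pscaleL (-1) L

/-- A single term times a term list. [folklore] -/
def mulTerm (t : ℤ × (Fin k → ℕ)) (M : List (ℤ × (Fin k → ℕ))) : List (ℤ × (Fin k → ℕ)) :=
  M.map fun s => (t.1 * s.1, t.2 + s.2)

/-- Product of two term lists. [folklore] -/
def pmulL : List (ℤ × (Fin k → ℕ)) → List (ℤ × (Fin k → ℕ)) → List (ℤ × (Fin k → ℕ))
  | [], _ => []
  | t :: ts, M => mulTerm t M ++ pmulL ts M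

/-- The constant term list `1`. [folklore] -/
def poneL : List (ℤ × (Fin k → ℕ)) := [(1, fun _ => 0)]

/-- Product of a list of term lists. [folklore] -/
def prodL : List (List (ℤ × (Fin k → ℕ))) → List (ℤ × (Fin k → ℕ))
  | [] => poneL
  | L :: Ls => pmulL L (prodL Ls)

/-- Insert a term, merging it with the first term of equal exponent vector. [folklore] -/
def addTerm (t : ℤ × (Fin k → ℕ)) : List (ℤ × (Fin k → ℕ)) → List (ℤ × (Fin k → ℕ))
  | [] => [t]
  | s :: rest => if s.2 = t.2 then (s.1 + t.1, s.2) :: rest else s :: addTerm t rest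

/-- Merge equal exponents. [folklore] -/
def collect (L : List (ℤ × (Fin k → ℕ))) : List (ℤ × (Fin k → ℕ)) := L.foldr addTerm []

/-- Zero test: after merging, every coefficient vanishes. [folklore] -/
def isZeroL (L : List (ℤ × (Fin k → ℕ))) : Bool := (collect L).all fun t => t.1 == 0

/-! ## Soundness -/

/-- `evalLV (t :: L) x = c·∏ + evalLV L x` (definitional unfolding). [folklore] -/
theorem evalLV_cons (t : ℤ × (Fin k → ℕ)) (L : List (ℤ × (Fin k → ℕ))) (x : Fin k → ℝ) :
    evalLV (t :: L) x = (t.1 : ℝ) * (∏ i, x i ^ t.2 i) + evalLV L x := rfl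

/-- `evalLV [] x = 0`. [folklore] -/
theorem evalLV_nil (x : Fin k → ℝ) : evalLV ([] : List (ℤ × (Fin k → ℕ))) x = 0 := rfl

/-- Soundness of `pscaleL`. [folklore] -/
theorem evalLV_pscaleL (c : ℤ) (L : List (ℤ × (Fin k → ℕ))) (x : Fin k → ℝ) : evalLV (pscaleL c L) x = (c : ℝ) * evalLV L x := by
  induction L with
  | nil => simp [pscaleL, evalLV_nil]
  | cons t ts ih =>
    simp only [pscaleL, List.map_cons] at ih ⊢
    rw [evalLV_cons, evalLV_cons, ih]
    push_cast
    ring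

/-- Soundness of `pnegL`. [folklore] -/
theorem evalLV_pnegL (L : List (ℤ × (Fin k → ℕ))) (x : Fin k → ℝ) : evalLV (pnegL L) x = -evalLV L x := by
  rw [pnegL, evalLV_pscaleL]; push_cast; ring

/-- Soundness of `mulTerm`. [folklore] -/
theorem evalLV_mulTerm (t : ℤ × (Fin k → ℕ)) (M : List (ℤ × (Fin k → ℕ))) (x : Fin k → ℝ) :
    evalLV (mulTerm t M) x = (t.1 : ℝ) * (∏ i, x i ^ t.2 i) * evalLV M x := by
  induction M with
  | nil => simp [mulTerm, evalLV_nil]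
  | cons s ss ih =>
    simp only [mulTerm, List.map_cons] at ih ⊢
    rw [evalLV_cons, evalLV_cons, ih]
    have hp : (∏ i, x i ^ (t.2 + s.2) i) = (∏ i, x i ^ t.2 i) * ∏ i, x i ^ s.2 i := by
      rw [← Finset.prod_mul_distrib]
      exact Finset.prod_congr rfl fun i _ => by rw [Pi.add_apply, pow_add]
    rw [hp]
    push_cast
    ring

/-- Soundness of `pmulL`. [folklore] -/
theorem evalLV_pmulL (L M : List (ℤ × (Fin k → ℕ))) (x : Fin k → ℝ) : evalLV (pmulL L M) x = evalLV L x * evalLV M x := by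
  induction L with
  | nil => simp [pmulL, evalLV_nil]
  | cons t ts ih => rw [pmulL, evalLV_append, evalLV_mulTerm, ih, evalLV_cons]; ring

/-- Soundness of `poneL`. [folklore] -/
theorem evalLV_poneL (x : Fin k → ℝ) : evalLV (poneL : List (ℤ × (Fin k → ℕ))) x = 1 := by
  simp [poneL, evalLV_cons, evalLV_nil]

/-- Soundness of `prodL`. [folklore] -/
theorem evalLV_prodL (Ls : List (List (ℤ × (Fin k → ℕ)))) (x : Fin k → ℝ) : evalLV (prodL Ls) x = (Ls.map fun L => evalLV L x).prod := by
  induction Ls with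
  | nil => simp [prodL, evalLV_poneL]
  | cons L Ls ih => rw [prodL, evalLV_pmulL, ih, List.map_cons, List.prod_cons]

/-- Soundness of `addTerm`. [folklore] -/
theorem evalLV_addTerm (t : ℤ × (Fin k → ℕ)) (L : List (ℤ × (Fin k → ℕ))) (x : Fin k → ℝ) :
    evalLV (addTerm t L) x = (t.1 : ℝ) * (∏ i, x i ^ t.2 i) + evalLV L x := by
  induction L with
  | nil => rfl
  | cons s ss ih =>
    by_cases h : s.2 = t.2
    · rw [addTerm, if_pos h, evalLV_cons, evalLV_cons, h]; push_cast; ring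
    · rw [addTerm, if_neg h, evalLV_cons, evalLV_cons, ih]; ring

/-- Soundness of `collect`. [folklore] -/
theorem evalLV_collect (L : List (ℤ × (Fin k → ℕ))) (x : Fin k → ℝ) : evalLV (collect L) x = evalLV L x := by
  induction L with
  | nil => rfl
  | cons t ts ih => rw [collect, List.foldr_cons, evalLV_addTerm, ← collect, ih, evalLV_cons]

/-- A term list all of whose merged coefficients vanish evaluates to `0`. [folklore] -/
theorem evalLV_eq_zero_of_isZeroL (L : List (ℤ × (Fin k → ℕ))) (h : isZeroL L = true) (x : Fin k → ℝ) : evalLV L x = 0 := by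
  rw [← evalLV_collect]
  rw [isZeroL, List.all_eq_true] at h
  generalize hC : collect L = C at h
  clear hC
  induction C with
  | nil => rfl
  | cons t ts ih =>
    have ht : t.1 = 0 := by simpa using h t (by simp)
    rw [evalLV_cons, ht, ih (fun s hs => h s (by simp [hs]))]
    push_cast; ring

/-- **Reflective identity check**: `isZeroL (L ++ pnegL M)` certifies `evalLV L x = evalLV M x` for every `x`. [folklore] -/
theorem evalLV_eq_of_isZeroL (L M : List (ℤ × (Fin k → ℕ))) (h : isZeroL (L ++ pnegL M) = true) (x : Fin k → ℝ) :
    evalLV L x = evalLV M x := by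
  have h0 := evalLV_eq_zero_of_isZeroL _ h x
  rw [evalLV_append, evalLV_pnegL] at h0
  linarith

/-! ## A small self-test: `(x₀ + x₁)² = x₀² + 2 x₀ x₁ + x₁²` by reflection -/

/-- Test data: `x₀ + x₁` as a term list in two variables. [this work] -/
def testLin : List (ℤ × (Fin 2 → ℕ)) := [((1 : ℤ), ![1, 0]), ((1 : ℤ), ![0, 1])]

/-- Test data: `x₀² + 2x₀x₁ + x₁²`. [this work] -/
def testSq : List (ℤ × (Fin 2 → ℕ)) := [((1 : ℤ), ![2, 0]), ((2 : ℤ), ![1, 1]), ((1 : ℤ), ![0, 2])]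

/-- The reflective check passes on the test identity (kernel `decide`). [this work] -/
theorem test_isZero : isZeroL (pmulL testLin testLin ++ pnegL testSq) = true := by
  decide +kernel

/-- Hence `(x₀+x₁)·(x₀+x₁) = x₀² + 2x₀x₁ + x₁²` as evaluations, with no symbolic expansion. [this work] -/
theorem test_identity (x : Fin 2 → ℝ) : evalLV testLin x * evalLV testLin x = evalLV testSq x := by
  rw [← evalLV_pmulL]; exact evalLV_eq_of_isZeroL _ _ test_isZero x

end SahiHitting

end Summit.CriticalPhenomena.PercolationContinuityZ3.Theorems
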